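import Literature.NumberTheory.GaloisRepresentations.InertiaHomFrobeniusTwist
import Literature.NumberTheory.GaloisRepresentations.LocalGaloisGroupProofs
import Mathlib.NumberTheory.Padics.PadicIntegers
import HarnessLib

/-!
# The prime-to-`p` part of a Frobenius: a cluster point of `φ^{p^{k!}}` (theorems only)

Topic `NumberTheory/GaloisRepresentations`; namespace `Literature.NumberTheory.GaloisRepresentations`.
THEOREMS ONLY (no definition, no named fact; D-0026).

In a compact group `G` the sequence `φ^{p^{k!}}` has a cluster point `g` ("`g = φ^e`" for the
idempotent `e ∈ Ẑ` with `e_p = 0`, `e_ℓ = 1` for `ℓ ≠ p`: `p^{k!} → e` in `Ẑ`). This file records the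
three properties of such a `g` that Greenberg–Vatsal's local computation at a place `v ∤ p` of the
cyclotomic `ℤ_p`-extension uses (Invent. Math. 142 (2000), §2 Prop. (2.4): the decomposition group
of a prime `η ∣ v` of `ℚ_∞` is topologically generated, modulo inertia, by the prime-to-`p` part of
the Frobenius, which acts on `μ_p` like the Frobenius and lies in `Gal(ℚ̄/ℚ_∞)`):

* `exists_mapClusterPt_pow_prime_pow_factorial` — existence of `g` (compactness);
* `MapClusterPt.apply_eq_of_eventually_eq`, `MapClusterPt.mem_of_isClosed_of_eventually` —
  continuous DISCRETE-valued functions which are eventually constant along the sequence take that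
  value at `g`; `g` lies in every closed set eventually containing the sequence;
* `map_eq_one_of_mapClusterPt` — **every continuous `ψ : G → ℤ_p` kills `g`**
  (`ψ(φ^{p^{k!}}) = p^{k!}·ψ(φ) → 0`): `g` fixes the `ℤ_p`-extension;
* `map_eq_of_mapClusterPt_of_pow_eq` — a continuous homomorphism `χ` to a discrete monoid with
  `χ(φ)^p = χ(φ)` (e.g. a sign, `p` odd) has `χ(g) = χ(φ)`;
* `apply_conj_eq_card_nsmul_of_mapClusterPt` — for a non-archimedean local field `F`, `φ` a
  Frobenius (`IsFrobPow φ 1`) and `f : I_F → B` a continuous homomorphism to a finite group killed by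
  `p ≠` residue characteristic: **`f(g σ g⁻¹) = q • f(σ)`** (`q^{p^{k!}} ≡ q (mod p)`;
  `InertiaHomFrobeniusTwist.apply_conj_eq_pow_nsmul_of_isFrobPow`, Serre 1972 §1.8 Prop. 6).

## References

* [GreenbergVatsal2000] R. Greenberg, V. Vatsal, *On the Iwasawa invariants of elliptic curves*,
  Invent. Math. 142 (2000), §2 Prop. (2.4) (pp. 22–23 of arXiv:math/9906215).
* [SerreInventiones1972] J.-P. Serre, Invent. Math. 15 (1972), §1.8 Prop. 6.
* [RibesZalesskii2010] L. Ribes, P. Zalesskii, *Profinite Groups*, 2nd ed., §2.3 and §4.1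
  (procyclic groups, `Ẑ = ∏ ℤ_ℓ`; powers `x^λ`, `λ ∈ Ẑ`).
-/

noncomputable section

open Function Filter
open scoped Topology

universe u

namespace Literature.NumberTheory.GaloisRepresentations

/-! ## §1. Cluster points of `φ^{p^{k!}}` in a compact group -/

section ClusterPt

variable {G : Type*} [TopologicalSpace G]

/-- In a compact monoid the sequence `φ^{p^{k!}}` has a cluster point (the "prime-to-`p` part" of
`φ`; Bourbaki's axiom (C): in a compact space every filter has a cluster point).
[cite: BourbakiGT1, Ch. I §9 no. 1 Def. 1 and axiom (C)] [cite: RibesZalesskii2010, §2.3 and §4.1] -/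
theorem exists_mapClusterPt_pow_prime_pow_factorial [Monoid G] [CompactSpace G] (φ : G) (p : ℕ) :
    ∃ g : G, MapClusterPt g atTop (fun k : ℕ => φ ^ p ^ k.factorial) :=
  exists_clusterPt_of_compactSpace _

variable {ι : Type*} {x : G} {L : Filter ι} {u : ι → G}

/-- A continuous function to a DISCRETE space takes at a cluster point of `u` along `L` a value it
takes frequently along `u` (a cluster point is adherent to every set of the filter).
[cite: BourbakiGT1, Ch. I §7 no. 3] -/
theorem MapClusterPt.frequently_apply_eq {D : Type*} [TopologicalSpace D] [DiscreteTopology D]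
    (h : MapClusterPt x L u) {f : G → D} (hf : Continuous f) : ∃ᶠ i in L, f (u i) = f x := by
  have hopen : IsOpen (f ⁻¹' {f x}) := (isOpen_discrete _).preimage hf
  exact MapClusterPt.frequently h (p := fun y => f y = f x) (hopen.mem_nhds rfl)

/-- If a continuous DISCRETE-valued function is eventually equal to `d` along `u`, it equals `d` at
every cluster point. [cite: BourbakiGT1, Ch. I §7 no. 3] -/
theorem MapClusterPt.apply_eq_of_eventually_eq {D : Type*} [TopologicalSpace D] [DiscreteTopology D]
    (h : MapClusterPt x L u) {f : G → D} (hf : Continuous f) {d : D}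
    (hd : ∀ᶠ i in L, f (u i) = d) : f x = d := by
  obtain ⟨i, hi, hi'⟩ := ((MapClusterPt.frequently_apply_eq h hf).and_eventually hd).exists
  rw [← hi, hi']

/-- A cluster point lies in every closed set which eventually contains the sequence (it is adherent
to that set). [cite: BourbakiGT1, Ch. I §7 no. 3] -/
theorem MapClusterPt.mem_of_isClosed_of_eventually (h : MapClusterPt x L u) {s : Set G}
    (hs : IsClosed s) (hu : ∀ᶠ i in L, u i ∈ s) : x ∈ s := by
  by_contra hx
  have hfr : ∃ᶠ i in L, u i ∈ sᶜ :=
    MapClusterPt.frequently h (p := fun y => y ∈ sᶜ) (hs.isOpen_compl.mem_nhds hx)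
  obtain ⟨i, hi, hi'⟩ := (hfr.and_eventually hu).exists
  exact hi hi'

end ClusterPt

/-! ## §2. `g` is killed by every continuous `ℤ_p`-valued homomorphism -/

section Zp

variable {G : Type*} [Group G] [TopologicalSpace G] {p : ℕ} [Fact p.Prime]

/-- **A cluster point of `φ^{p^{k!}}` lies in the kernel of every continuous homomorphism
`ψ : G → ℤ_p`** (written multiplicatively): `ψ(φ^{p^{k!}}) = p^{k!} · ψ(φ)` has norm `≤ p^{-k!} → 0`,
and each `{y : ‖ψ y‖ ≤ p^{-n}}` is closed. (For `G = Γ_ℚ` and `ψ` the cyclotomic `ℤ_p`-extension: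
`g ∈ Gal(ℚ̄/ℚ_∞)`.) [cite: GreenbergVatsal2000, §2 Prop. (2.4)] -/
theorem map_eq_one_of_mapClusterPt (ψ : G →ₜ* Multiplicative ℤ_[p]) {φ g : G}
    (hg : MapClusterPt g atTop (fun k : ℕ => φ ^ p ^ k.factorial)) : ψ g = 1 := by
  have hp1 : 1 < (p : ℝ) := by exact_mod_cast (Fact.out : p.Prime).one_lt
  -- `‖ψ g‖ ≤ p^{-n}` for every `n`
  have hle : ∀ n : ℕ, ‖(ψ g).toAdd‖ ≤ (p : ℝ) ^ (-(n : ℤ)) := by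
    intro n
    have hclosed : IsClosed {y : G | ‖(ψ y).toAdd‖ ≤ (p : ℝ) ^ (-(n : ℤ))} :=
      isClosed_le ((continuous_norm.comp (continuous_toAdd.comp ψ.continuous_toFun)))
        continuous_const
    refine MapClusterPt.mem_of_isClosed_of_eventually hg hclosed ?_
    refine (eventually_ge_atTop n).mono fun k hk => ?_
    change ‖(ψ (φ ^ p ^ k.factorial)).toAdd‖ ≤ (p : ℝ) ^ (-(n : ℤ))
    rw [map_pow, toAdd_pow, nsmul_eq_mul, norm_mul, Nat.cast_pow, norm_pow, PadicInt.norm_p,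
      inv_pow, ← zpow_natCast, ← zpow_neg]
    calc (p : ℝ) ^ (-(k.factorial : ℤ)) * ‖(ψ φ).toAdd‖
        ≤ (p : ℝ) ^ (-(k.factorial : ℤ)) * 1 :=
          mul_le_mul_of_nonneg_left (PadicInt.norm_le_one _) (zpow_nonneg (by positivity) _)
      _ ≤ (p : ℝ) ^ (-(n : ℤ)) := by
          rw [mul_one]
          refine zpow_le_zpow_right₀ hp1.le (neg_le_neg ?_)
          exact_mod_cast hk.trans (Nat.self_le_factorial k)
  -- hence `ψ g = 0`
  have ht : Tendsto (fun n : ℕ => (p : ℝ) ^ (-(n : ℤ))) atTop (𝓝 0) := by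
    have : Tendsto (fun n : ℕ => ((p : ℝ)⁻¹) ^ n) atTop (𝓝 0) :=
      tendsto_pow_atTop_nhds_zero_of_lt_one (by positivity) (inv_lt_one_of_one_lt₀ hp1)
    refine this.congr fun n => ?_
    rw [inv_pow, ← zpow_natCast, ← zpow_neg]
  have h0 : ‖(ψ g).toAdd‖ ≤ 0 := ge_of_tendsto ht (Eventually.of_forall hle)
  have : (ψ g).toAdd = 0 := norm_le_zero_iff.mp h0
  exact toAdd_eq_zero.mp this

end Zp

/-! ## §3. Discrete characters of order dividing `p - 1` (signs) -/

section Sign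

variable {G : Type*} [Monoid G] [TopologicalSpace G]

/-- If `χ : G → M` is a continuous homomorphism to a DISCRETE monoid with `χ(φ)^p = χ(φ)` (e.g.
`χ(φ) = ±1` and `p` odd), then `χ(g) = χ(φ)` at every cluster point `g` of `φ^{p^{k!}}`: indeed
`χ(φ^{p^{k!}}) = χ(φ)` for all `k`. [cite: GreenbergVatsal2000, §2 Prop. (2.4)] -/
theorem map_eq_of_mapClusterPt_of_pow_eq {M : Type*} [Monoid M] [TopologicalSpace M]
    [DiscreteTopology M] (χ : G →* M) (hχ : Continuous χ) {p : ℕ} {φ g : G}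
    (hg : MapClusterPt g atTop (fun k : ℕ => φ ^ p ^ k.factorial)) (hφ : χ φ ^ p = χ φ) :
    χ g = χ φ := by
  have hpow : ∀ m : ℕ, χ φ ^ p ^ m = χ φ := by
    intro m
    induction m with
    | zero => rw [pow_zero, pow_one]
    | succ m ih => rw [pow_succ, pow_mul, ih, hφ]
  exact MapClusterPt.apply_eq_of_eventually_eq hg hχ (Eventually.of_forall fun k => by
    rw [map_pow, hpow])

end Sign

/-! ## §4. Conjugation of tame homomorphisms by `g`: `f(g σ g⁻¹) = q • f(σ)` on `p`-torsion -/

section Local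

open scoped Valued
open Field ValuativeRel
open GaloisRepresentations.IsNonarchimedeanLocalField

variable (F : Type u) [Field F] [ValuativeRel F] [TopologicalSpace F] [IsNonarchimedeanLocalField F]

/-- Powers of a Frobenius are Frobenius powers: `IsFrobPow (φ ^ k) k` (as in `LocalFieldCdTwo`).
[folklore] -/
private theorem isFrobPow_pow_aux {φ : absoluteGaloisGroup F} (hφ : IsFrobPow φ 1) :
    ∀ k : ℕ, IsFrobPow (φ ^ k) (k : ℤ)
  | 0 => by rw [pow_zero]; exact IsFrobPow.one
  | k + 1 => by
    rw [pow_succ, Nat.cast_succ]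
    exact IsFrobPow.mul_holds (isFrobPow_pow_aux hφ k) hφ

/-- `q^{p^m} ≡ q (mod p)` (Fermat), in the form: `q^{p^m} • b = q • b` whenever `p • b = 0`.
[folklore] -/
private theorem pow_prime_pow_nsmul_eq_of_prime_nsmul_eq_zero {B : Type*} [AddCommGroup B] {p : ℕ}
    [Fact p.Prime] (q m : ℕ) {b : B} (hb : p • b = 0) : (q ^ p ^ m) • b = q • b := by
  have hmod : ∀ n : ℕ, n • b = (n % p) • b := fun n => by
    conv_lhs => rw [← Nat.mod_add_div n p, add_nsmul, mul_nsmul, hb, nsmul_zero, add_zero]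
  have hcong : (q ^ p ^ m) % p = q % p := by
    have h : ((q ^ p ^ m : ℕ) : ZMod p) = (q : ZMod p) := by
      rw [Nat.cast_pow, ZMod.pow_card_pow]
    exact (ZMod.natCast_eq_natCast_iff' _ _ _).mp h
  rw [hmod (q ^ p ^ m), hcong, ← hmod q]

/-- **Conjugation by the prime-to-`p` part of a Frobenius multiplies `p`-torsion tame homomorphisms
by `q`.** Let `B` be a finite discrete abelian group of order prime to the residue characteristic and
killed by the prime `p`, `f : I_F → B` a continuous homomorphism, `φ ∈ Γ_F` a Frobenius
(`IsFrobPow φ 1`), and `g` a cluster point of `φ^{p^{k!}}`. Then `f(g σ g⁻¹) = q • f(σ)` for all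
`σ ∈ I_F` (`q = residueFieldCard F`): `f(φ^N σ φ^{-N}) = q^N • f(σ)`
(`apply_conj_eq_pow_nsmul_of_isFrobPow`), `q^{p^{k!}} ≡ q (mod p)`, and `x ↦ f(x σ x⁻¹)` is
locally constant. [cite: SerreInventiones1972, §1.8 Prop. 6] [cite: GreenbergVatsal2000, §2 Prop. (2.4)] -/
theorem apply_conj_eq_card_nsmul_of_mapClusterPt
    {B : Type*} [AddCommGroup B] [Finite B] [TopologicalSpace B] [DiscreteTopology B]
    (hB : (Nat.card B).Coprime (ringChar 𝓀[F])) {p : ℕ} [Fact p.Prime] (hpB : ∀ b : B, p • b = 0)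
    (f : absInertia F → B) (hf : ∀ x y, f (x * y) = f x + f y) (hfc : Continuous f)
    {φ g : absoluteGaloisGroup F} (hφ : IsFrobPow φ 1)
    (hg : MapClusterPt g atTop (fun k : ℕ => φ ^ p ^ k.factorial)) (σ : absInertia F) :
    f ⟨g * σ * g⁻¹, (inferInstance : (absInertia F).Normal).conj_mem _ σ.2 g⟩ =
      residueFieldCard F • f σ := by
  -- the locally constant function `x ↦ f (x σ x⁻¹)`
  let c : absoluteGaloisGroup F → B := fun x =>
    f ⟨x * σ * x⁻¹, (inferInstance : (absInertia F).Normal).conj_mem _ σ.2 x⟩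
  have hc : Continuous c := by
    refine hfc.comp (Continuous.subtype_mk ?_ _)
    exact (continuous_id.mul continuous_const).mul continuous_inv
  have hval : ∀ k : ℕ, c (φ ^ p ^ k.factorial) = residueFieldCard F • f σ := by
    intro k
    change f ⟨φ ^ p ^ k.factorial * σ * (φ ^ p ^ k.factorial)⁻¹, _⟩ = _
    rw [apply_conj_eq_pow_nsmul_of_isFrobPow F hB f hf hfc (isFrobPow_pow_aux F hφ _) σ]
    exact pow_prime_pow_nsmul_eq_of_prime_nsmul_eq_zero _ _ (hpB _)
  exact MapClusterPt.apply_eq_of_eventually_eq hg hc (Eventually.of_forall hval)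

end Local

end Literature.NumberTheory.GaloisRepresentations

end
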